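import Summits.HubbardSuperconductivity.HubbardSuperconductivity.Theorems.AnisotropyChordTransferFibre3TwoChannel

/-!
# Route `AnisotropyChord` / H0 rotor rung: PartN40 — the EXACT TWO-CHANNEL REDUCTION, PROVED

PORT PartN40 (`…Fibre3TwoChannel`, theory seat `hubbard-h0-rotor-theory-1` g21, memo 21 §318(g),(h), §324; THEOREMS M140) types
`TwoChannel.TwoChannelReduction : Prop`: for a reflection-symmetric deleted pair,
`Wᵀ · P[fromBlocks A₀ M M A₀, Λ] · W = 2 · fromBlocks (P₁[A₀ + M, 2Λ]) 0 0 (P₁[A₀ − M, 0])`.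
This file proves it (`twoChannelReduction_holds`).  Proof: the block inverse
`(fromBlocks A₀ M M A₀)⁻¹ = fromBlocks P Q Q P`, `P = ((A₀+M)⁻¹ + (A₀−M)⁻¹)/2`, `Q = ((A₀+M)⁻¹ − (A₀−M)⁻¹)/2`
(`fromBlocks_inv_even_odd`), whence `x = A⁻¹1 = (x₊, x₊)` with `x₊ = (A₀+M)⁻¹1` and `s = 2s₊` (`xvec2_fromBlocks`,
`svec2_fromBlocks`); the two-hole map is then `fromBlocks T₁ T₂ T₂ T₁` and `Wᵀ(·)W` block-diagonalises it into
`2(T₁ + T₂) = 2P₁[A₀+M, 2Λ]` and `2(T₁ − T₂) = 2P₁[A₀−M, 0]` (the rank-one term lives in the even channel only).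
The symmetry hypotheses `A₀.IsSymm`, `M.IsSymm` of the typed statement are NOT needed (checked: the identity holds for
arbitrary `A₀`, `M` with `A₀ ± M` invertible); they are simply carried.
Prover seat `hubbard-h0-rotor-p2` g0; helper for stmt-HubbardSuperconductivity-19089 (`--supports`, helper class).
WHAT THIS IS NOT: nothing here proves superconductivity in the Hubbard model; helper algebra of ONE conditional reduction
(rung 19089, HOLE₂(.75) far pairs, THEOREM H2F).  Mathlib only; no sorry, no axioms.
-/

set_option linter.dupNamespace false
namespace Summit.HubbardSuperconductivity.HubbardSuperconductivity.Theorems.AnisotropyChord.Transfer.Fibre3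

namespace TwoChannel

open Matrix

/-- EVEN/ODD BLOCK INVERSE: `(fromBlocks A₀ M M A₀)⁻¹ = fromBlocks P Q Q P` with `P = ((A₀+M)⁻¹ + (A₀−M)⁻¹)/2`,
`Q = ((A₀+M)⁻¹ − (A₀−M)⁻¹)/2`, whenever `A₀ ± M` are invertible. -/
theorem fromBlocks_inv_even_odd (A₀ M : Matrix (Fin 5) (Fin 5) ℝ)
    (hp : IsUnit (A₀ + M).det) (hm : IsUnit (A₀ - M).det) :
    (Matrix.fromBlocks A₀ M M A₀)⁻¹ =
      Matrix.fromBlocks ((1 / 2 : ℝ) • ((A₀ + M)⁻¹ + (A₀ - M)⁻¹)) ((1 / 2 : ℝ) • ((A₀ + M)⁻¹ - (A₀ - M)⁻¹))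
        ((1 / 2 : ℝ) • ((A₀ + M)⁻¹ - (A₀ - M)⁻¹)) ((1 / 2 : ℝ) • ((A₀ + M)⁻¹ + (A₀ - M)⁻¹)) := by
  apply Matrix.inv_eq_right_inv
  have hBp : (A₀ + M) * (A₀ + M)⁻¹ = 1 := Matrix.mul_nonsing_inv _ hp
  have hBm : (A₀ - M) * (A₀ - M)⁻¹ = 1 := Matrix.mul_nonsing_inv _ hm
  set Bp := (A₀ + M)⁻¹
  set Bm := (A₀ - M)⁻¹
  have htwo : ((1 / 2 : ℝ) • ((1 : Matrix (Fin 5) (Fin 5) ℝ) + 1)) = 1 := by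
    rw [← two_smul ℝ (1 : Matrix (Fin 5) (Fin 5) ℝ), smul_smul]
    norm_num
  have e11 : A₀ * ((1 / 2 : ℝ) • (Bp + Bm)) + M * ((1 / 2 : ℝ) • (Bp - Bm))
      = (1 / 2 : ℝ) • ((A₀ + M) * Bp + (A₀ - M) * Bm) := by
    simp only [Matrix.mul_smul, Matrix.mul_add, Matrix.mul_sub, Matrix.add_mul, Matrix.sub_mul, smul_add,
      smul_sub]
    abel
  have e12 : A₀ * ((1 / 2 : ℝ) • (Bp - Bm)) + M * ((1 / 2 : ℝ) • (Bp + Bm))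
      = (1 / 2 : ℝ) • ((A₀ + M) * Bp - (A₀ - M) * Bm) := by
    simp only [Matrix.mul_smul, Matrix.mul_add, Matrix.mul_sub, Matrix.add_mul, Matrix.sub_mul, smul_add,
      smul_sub]
    abel
  have e21 : M * ((1 / 2 : ℝ) • (Bp + Bm)) + A₀ * ((1 / 2 : ℝ) • (Bp - Bm))
      = (1 / 2 : ℝ) • ((A₀ + M) * Bp - (A₀ - M) * Bm) := by
    simp only [Matrix.mul_smul, Matrix.mul_add, Matrix.mul_sub, Matrix.add_mul, Matrix.sub_mul, smul_add,
      smul_sub]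
    abel
  have e22 : M * ((1 / 2 : ℝ) • (Bp - Bm)) + A₀ * ((1 / 2 : ℝ) • (Bp + Bm))
      = (1 / 2 : ℝ) • ((A₀ + M) * Bp + (A₀ - M) * Bm) := by
    simp only [Matrix.mul_smul, Matrix.mul_add, Matrix.mul_sub, Matrix.add_mul, Matrix.sub_mul, smul_add,
      smul_sub]
    abel
  rw [Matrix.fromBlocks_multiply, e11, e12, e21, e22, hBp, hBm, sub_self, smul_zero, htwo, Matrix.fromBlocks_one]

/-- the harmonic-measure vector of the reflection-symmetric pair is even: `x = (x₊, x₊)`, `x₊ = (A₀+M)⁻¹1`. -/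
theorem xvec2_fromBlocks (A₀ M : Matrix (Fin 5) (Fin 5) ℝ)
    (hp : IsUnit (A₀ + M).det) (hm : IsUnit (A₀ - M).det) :
    xvec2 (Matrix.fromBlocks A₀ M M A₀) = Sum.elim (xvec (A₀ + M)) (xvec (A₀ + M)) := by
  unfold xvec2
  rw [fromBlocks_inv_even_odd A₀ M hp hm, Matrix.fromBlocks_mulVec]
  have hPQ : (1 / 2 : ℝ) • ((A₀ + M)⁻¹ + (A₀ - M)⁻¹) + (1 / 2 : ℝ) • ((A₀ + M)⁻¹ - (A₀ - M)⁻¹) = (A₀ + M)⁻¹ := by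
    ext i j
    simp only [Matrix.add_apply, Matrix.smul_apply, Matrix.sub_apply, smul_eq_mul]
    ring
  have hQP : (1 / 2 : ℝ) • ((A₀ + M)⁻¹ - (A₀ - M)⁻¹) + (1 / 2 : ℝ) • ((A₀ + M)⁻¹ + (A₀ - M)⁻¹) = (A₀ + M)⁻¹ := by
    ext i j
    simp only [Matrix.add_apply, Matrix.smul_apply, Matrix.sub_apply, smul_eq_mul]
    ring
  have h1 : ((fun _ : Fin 5 ⊕ Fin 5 => (1 : ℝ)) ∘ Sum.inl) = fun _ : Fin 5 => (1 : ℝ) := rfl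
  have h2 : ((fun _ : Fin 5 ⊕ Fin 5 => (1 : ℝ)) ∘ Sum.inr) = fun _ : Fin 5 => (1 : ℝ) := rfl
  rw [h1, h2, ← Matrix.add_mulVec, ← Matrix.add_mulVec, hPQ, hQP]
  rfl

/-- `s = 2 s₊`. -/
theorem svec2_fromBlocks (A₀ M : Matrix (Fin 5) (Fin 5) ℝ)
    (hp : IsUnit (A₀ + M).det) (hm : IsUnit (A₀ - M).det) :
    svec2 (Matrix.fromBlocks A₀ M M A₀) = 2 * svec (A₀ + M) := by
  unfold svec2
  rw [xvec2_fromBlocks A₀ M hp hm, Fintype.sum_sum_type]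
  simp only [Sum.elim_inl, Sum.elim_inr, svec]
  ring

/-- ★ THE TWO-CHANNEL REDUCTION (memo §318(g),(h), §324) holds. -/
theorem twoChannelReduction_holds : TwoChannelReduction := by
  intro A₀ M Λ _hA _hM hp hm hs
  have hinv := fromBlocks_inv_even_odd A₀ M hp hm
  have hx := xvec2_fromBlocks A₀ M hp hm
  have hsv := svec2_fromBlocks A₀ M hp hm
  rw [hsv] at hs
  set Bp := (A₀ + M)⁻¹ with hBp
  set Bm := (A₀ - M)⁻¹ with hBm
  set xp := xvec (A₀ + M) with hxp
  set sp := svec (A₀ + M) with hsp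
  -- the two-hole map in block form
  set T₁ : Matrix (Fin 4) (Fin 4) ℝ := Matrix.of fun i j =>
    -((1 / 2 : ℝ) • (Bp + Bm)) i.succ j.succ + Λ / (Λ * (2 * sp) - 1) * xp i.succ * xp j.succ
      - (if i = j then (1 : ℝ) / 2 else 0) with hT₁
  set T₂ : Matrix (Fin 4) (Fin 4) ℝ := Matrix.of fun i j =>
    -((1 / 2 : ℝ) • (Bp - Bm)) i.succ j.succ + Λ / (Λ * (2 * sp) - 1) * xp i.succ * xp j.succ with hT₂
  have hT : twoHoleP (Matrix.fromBlocks A₀ M M A₀) Λ = Matrix.fromBlocks T₁ T₂ T₂ T₁ := by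
    ext (i | i) (j | j)
    · simp [twoHoleP, emb, hinv, hx, hsv, hT₁]
      ring
    · simp [twoHoleP, emb, hinv, hx, hsv, hT₂]
    · simp [twoHoleP, emb, hinv, hx, hsv, hT₂]
    · simp [twoHoleP, emb, hinv, hx, hsv, hT₁]
      ring
  rw [hT]
  simp only [W, Matrix.fromBlocks_transpose, Matrix.transpose_one, Matrix.transpose_neg, Matrix.fromBlocks_multiply,
    Matrix.one_mul, Matrix.mul_one, Matrix.neg_mul, Matrix.mul_neg, Matrix.one_mul, Matrix.fromBlocks_smul,
    smul_zero, Matrix.fromBlocks_inj]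
  refine ⟨?_, ?_, ?_, ?_⟩
  · ext i j
    simp only [hT₁, hT₂, oneHoleP, Matrix.add_apply, Matrix.smul_apply, Matrix.of_apply, Matrix.sub_apply,
      smul_eq_mul]
    ring
  · ext i j
    simp only [hT₁, hT₂, Matrix.add_apply, Matrix.neg_apply, Matrix.of_apply, Matrix.zero_apply,
      Matrix.smul_apply, Matrix.sub_apply, smul_eq_mul]
    ring
  · ext i j
    simp only [hT₁, hT₂, Matrix.add_apply, Matrix.neg_apply, Matrix.of_apply, Matrix.zero_apply,
      Matrix.smul_apply, Matrix.sub_apply, smul_eq_mul]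
    ring
  · ext i j
    simp only [hT₁, hT₂, oneHoleP, Matrix.add_apply, Matrix.smul_apply, Matrix.of_apply, Matrix.sub_apply,
      Matrix.neg_apply, smul_eq_mul, zero_mul, zero_div, zero_sub]
    ring

end TwoChannel

end Summit.HubbardSuperconductivity.HubbardSuperconductivity.Theorems.AnisotropyChord.Transfer.Fibre3
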